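import Summits.KontsevichZagierPeriods.KontsevichZagierPeriods.Theorems.CobordismMoveCobordismInvarianceCell
import Summits.KontsevichZagierPeriods.KontsevichZagierPeriods.Theses.CobordismMove
import Mathlib.Analysis.Calculus.FDeriv.Equiv

/-!
# Route CobordismMove — `CobordismInvariance`, part 2: homologous Nash chains give KZ-equivalent representations

Problem `KontsevichZagierPeriods`, route `CobordismMove`, support item stmt-KontsevichZagierPeriods-6762
(`CobordismInvariance`, informal in the route file: "cobordant (homologous) Nash cycles give
KZ-equivalent representations of every closed polynomial form; with `TorsionFree` rational homology
suffices"). In the vocabulary of `Literature/NumberTheory/Transcendental/SemialgebraicCubicalChain.lean`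
(`SemialgebraicCubicalChain`, `boundary`, `KZ.chainRep`) this file proves, from the cell-level Stokes
relation of part 1 (`chainRep_boundary_of_mem_relations`):

* `chainRep_boundary_mem_relations` — Stokes along a `ℚ`-semialgebraic cubical `(d+1)`-chain `Γ`:
  `KZ.chainRep (∂ Γ) ω ∈ KZ.relations` when `ω` (semialgebraic coefficients, differentiable on an open
  `S`) is closed along every cell of `Γ` (cells `C²` on the open cube, mapping the closed cube into `S`);
* `chainRep_sub_chainRep_mem_relations` — **cobordism / homology invariance**: `Z − Z' = ∂ Γ` implies
  `KZ.chainRep Z ω − KZ.chainRep Z' ω ∈ KZ.relations`;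
* `cobordismInvariance` — the same with closedness stated on a set `V ⊇` the cells of `Γ`:
  `dω` vanishes on tuples of tangent vectors of `V` (`tangentConeAt ℝ V x`), i.e. `dω|_V = 0`;
* `cobordismInvariance_of_extDeriv_eq_zero` — forms closed on `S` outright;
* `cobordismInvariance_rat` — the rational-homology version `n • (Z − Z') = ∂ Γ`, `n ≠ 0`, GIVEN the
  route's support item `TorsionFree` (stmt-3169) as a hypothesis (conditional on that item only);
* `cobordismInvariance_polynomialForm` — the informal item's literal setting `ω = Σ_I a_I dx_I`,
  `a_I ∈ ℚ[x₁, …, x_N]` (`S = ℝᴺ`; semialgebraicity and smoothness of such forms proved here).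

Sources: M. Spivak, *Calculus on Manifolds* (1965), Thm. 4-13; M. Kontsevich, D. Zagier, *Periods*
(2001), §1.2, rule (3); J. Bochnak, M. Coste, M.-F. Roy, *Real Algebraic Geometry* (1998), §11.7
(semialgebraic chains). No definition, no named fact.
-/

noncomputable section

open MeasureTheory Set Function
open Literature.NumberTheory.Transcendental
open Literature.ModelTheory.ExponentialFields (IsSemialgebraic)

namespace Summit.KontsevichZagierPeriods.CobordismMove.CobordismInvariance

variable {d N : ℕ} {S : Set (Fin N → ℝ)} {ω : (Fin N → ℝ) → (Fin N → ℝ) [⋀^Fin d]→L[ℝ] ℝ}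

/-- **Stokes along a Nash cubical chain is a KZ relation.** For a `d`-form `ω` with `ℚ`-semialgebraic
coefficients, differentiable on an open `S ⊆ ℝᴺ`, and a `ℚ`-semialgebraic cubical `(d+1)`-chain `Γ`
whose cells map the closed cube into `S`, are `C²` on the open cube, and along which `ω` is closed
(`c^*(dω) = 0` on the open cube), the boundary representation `KZ.chainRep (∂ Γ) ω` lies in
`KZ.relations` (cell by cell, `chainRep_boundary_of_mem_relations`, and additivity of
`KZ.chainRep`). [cite: Spivak1965, Thm. 4-13] -/
theorem chainRep_boundary_mem_relations (hSo : IsOpen S) (hω : IsSemialgebraicFormOn S ω)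
    (hωd : DifferentiableOn ℝ ω S) (Γ : SemialgebraicCubicalChain (d + 1) N)
    (hΓS : ∀ c ∈ Γ.support, MapsTo c (closedUnitCube (d + 1)) S)
    (hΓ2 : ∀ c ∈ Γ.support, ContDiffOn ℝ 2 c (openUnitCube (d + 1)))
    (hclosed : ∀ c ∈ Γ.support, ∀ y ∈ openUnitCube (d + 1),
      pullbackDensity c (extDeriv ω) y = 0) :
    KZ.chainRep (SemialgebraicCubicalChain.boundary Γ) ω ∈ KZ.relations := by
  rw [← SemialgebraicCubicalChain.sum_coeff_smul_of Γ, map_sum, KZ.chainRep_sum]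
  refine sum_mem fun c hc => ?_
  rw [map_zsmul, KZ.chainRep_zsmul]
  exact KZ.relations.zsmul_mem
    (chainRep_boundary_of_mem_relations hSo hω hωd c (hΓS c hc) (hΓ2 c hc) (hclosed c hc)) _

/-- **Cobordism (homology) invariance of the KZ representation of a closed form.** If two
`ℚ`-semialgebraic cubical `d`-chains `Z, Z'` are homologous through a `(d+1)`-chain `Γ`
(`Z − Z' = ∂ Γ`) along whose cells `ω` is closed (hypotheses of
`chainRep_boundary_mem_relations`), then `KZ.chainRep Z ω − KZ.chainRep Z' ω ∈ KZ.relations`: the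
two representations of `∫_Z ω = ∫_{Z'} ω` are equivalent under the Kontsevich–Zagier moves.
[cite: KontsevichZagier2001, §1.2, rule (3)] -/
theorem chainRep_sub_chainRep_mem_relations (hSo : IsOpen S) (hω : IsSemialgebraicFormOn S ω)
    (hωd : DifferentiableOn ℝ ω S) (Γ : SemialgebraicCubicalChain (d + 1) N)
    (hΓS : ∀ c ∈ Γ.support, MapsTo c (closedUnitCube (d + 1)) S)
    (hΓ2 : ∀ c ∈ Γ.support, ContDiffOn ℝ 2 c (openUnitCube (d + 1)))
    (hclosed : ∀ c ∈ Γ.support, ∀ y ∈ openUnitCube (d + 1),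
      pullbackDensity c (extDeriv ω) y = 0)
    (Z Z' : SemialgebraicCubicalChain d N) (hZ : Z - Z' = SemialgebraicCubicalChain.boundary Γ) :
    KZ.chainRep Z ω - KZ.chainRep Z' ω ∈ KZ.relations := by
  rw [← KZ.chainRep_sub, hZ]
  exact chainRep_boundary_mem_relations hSo hω hωd Γ hΓS hΓ2 hclosed

/-- The derivative of a cell at a point of the open cube maps into the tangent cone of any set `V`
containing the image of the open cube. [folklore] -/
theorem fderiv_apply_mem_tangentConeAt {V : Set (Fin N → ℝ)} (c : NashCubeMap (d + 1) N)
    (hcV : MapsTo c (openUnitCube (d + 1)) V) {y : Fin (d + 1) → ℝ} (hy : y ∈ openUnitCube (d + 1))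
    (v : Fin (d + 1) → ℝ) : fderiv ℝ c y v ∈ tangentConeAt ℝ V (c y) := by
  have hd : HasFDerivWithinAt c (fderiv ℝ c y) (openUnitCube (d + 1)) y :=
    (c.differentiableAt (openUnitCube_subset_closedUnitCube hy)).hasFDerivAt.hasFDerivWithinAt
  have h1 := hd.mapsTo_tangent_cone (x := y)
    (by rw [tangentConeAt_of_mem_nhds (isOpen_openUnitCube.mem_nhds hy)]; exact mem_univ v)
  exact tangentConeAt_mono hcV.image_subset h1

/-- **CobordismInvariance** (item stmt-KontsevichZagierPeriods-6762, typed in the tree's vocabulary).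
Let `ω` be a `d`-form with `ℚ`-semialgebraic coefficients, differentiable on an open `S ⊆ ℝᴺ`
(e.g. a form with `ℚ`-polynomial coefficients, `S = ℝᴺ`), and let `V ⊆ S` be a set on which `ω` is
CLOSED: `dω` vanishes on every tuple of tangent vectors of `V` (`tangentConeAt ℝ V x`; for a
nonsingular real algebraic `V` this is `dω|_V = 0`). If two `ℚ`-semialgebraic cubical `d`-chains
`Z, Z'` are homologous IN `V` — `Z − Z' = ∂ Γ` for a `(d+1)`-chain `Γ` whose cells map the closed
cube into `V` and are `C²` on the open cube — then their representations of `ω` are KZ-equivalent: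
`KZ.chainRep Z ω − KZ.chainRep Z' ω ∈ KZ.relations`. (The cells' derivatives at interior points are
tangent to `V`, so `c^*(dω) = 0`, and `chainRep_sub_chainRep_mem_relations` applies.)
[cite: KontsevichZagier2001, §1.2, rule (3)] -/
theorem cobordismInvariance (hSo : IsOpen S) (hω : IsSemialgebraicFormOn S ω)
    (hωd : DifferentiableOn ℝ ω S) {V : Set (Fin N → ℝ)} (hVS : V ⊆ S)
    (hdωV : ∀ x ∈ V, ∀ v : Fin (d + 1) → (Fin N → ℝ), (∀ i, v i ∈ tangentConeAt ℝ V x) →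
      extDeriv ω x v = 0)
    (Γ : SemialgebraicCubicalChain (d + 1) N)
    (hΓV : ∀ c ∈ Γ.support, MapsTo c (closedUnitCube (d + 1)) V)
    (hΓ2 : ∀ c ∈ Γ.support, ContDiffOn ℝ 2 c (openUnitCube (d + 1)))
    (Z Z' : SemialgebraicCubicalChain d N) (hZ : Z - Z' = SemialgebraicCubicalChain.boundary Γ) :
    KZ.chainRep Z ω - KZ.chainRep Z' ω ∈ KZ.relations := by
  refine chainRep_sub_chainRep_mem_relations hSo hω hωd Γ (fun c hc => (hΓV c hc).mono_right hVS)
    hΓ2 (fun c hc y hy => ?_) Z Z' hZ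
  rw [pullbackDensity_apply]
  exact hdωV _ (hΓV c hc (openUnitCube_subset_closedUnitCube hy)) _ fun i =>
    fderiv_apply_mem_tangentConeAt c ((hΓV c hc).mono_left openUnitCube_subset_closedUnitCube) hy _

/-- **CobordismInvariance for forms closed on the ambient open set** (`dω = 0` on `S`, e.g. a closed
form with `ℚ`-polynomial coefficients on `ℝᴺ`): homologous chains `Z − Z' = ∂ Γ` (cells of `Γ` in
`S`, `C²` on the open cube) give `KZ.chainRep Z ω − KZ.chainRep Z' ω ∈ KZ.relations`.
[cite: KontsevichZagier2001, §1.2, rule (3)] -/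
theorem cobordismInvariance_of_extDeriv_eq_zero (hSo : IsOpen S) (hω : IsSemialgebraicFormOn S ω)
    (hωd : DifferentiableOn ℝ ω S) (hdω : ∀ x ∈ S, extDeriv ω x = 0)
    (Γ : SemialgebraicCubicalChain (d + 1) N)
    (hΓS : ∀ c ∈ Γ.support, MapsTo c (closedUnitCube (d + 1)) S)
    (hΓ2 : ∀ c ∈ Γ.support, ContDiffOn ℝ 2 c (openUnitCube (d + 1)))
    (Z Z' : SemialgebraicCubicalChain d N) (hZ : Z - Z' = SemialgebraicCubicalChain.boundary Γ) :
    KZ.chainRep Z ω - KZ.chainRep Z' ω ∈ KZ.relations := by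
  refine chainRep_sub_chainRep_mem_relations hSo hω hωd Γ hΓS hΓ2 (fun c hc y hy => ?_) Z Z' hZ
  rw [pullbackDensity_apply, hdω _ (hΓS c hc (openUnitCube_subset_closedUnitCube hy))]
  rfl

/-- **CobordismInvariance with rational homology**, GIVEN the route's support item `TorsionFree`
(stmt-KontsevichZagierPeriods-3169: `n ≠ 0`, `n • c ∈ KZ.relations ⇒ c ∈ KZ.relations`) as a
hypothesis: if `n • (Z − Z') = ∂ Γ` in `V` with `n ≠ 0` (the chains are rationally homologous in
`V`), then `KZ.chainRep Z ω − KZ.chainRep Z' ω ∈ KZ.relations`. Conditional on `TorsionFree` only.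
[cite: KontsevichZagier2001, §1.2, rule (3)] -/
theorem cobordismInvariance_rat
    (hT : Summit.KontsevichZagierPeriods.KontsevichZagierPeriods.Theses.CobordismMove.TorsionFree)
    (hSo : IsOpen S) (hω : IsSemialgebraicFormOn S ω) (hωd : DifferentiableOn ℝ ω S)
    {V : Set (Fin N → ℝ)} (hVS : V ⊆ S)
    (hdωV : ∀ x ∈ V, ∀ v : Fin (d + 1) → (Fin N → ℝ), (∀ i, v i ∈ tangentConeAt ℝ V x) →
      extDeriv ω x v = 0)
    (Γ : SemialgebraicCubicalChain (d + 1) N)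
    (hΓV : ∀ c ∈ Γ.support, MapsTo c (closedUnitCube (d + 1)) V)
    (hΓ2 : ∀ c ∈ Γ.support, ContDiffOn ℝ 2 c (openUnitCube (d + 1)))
    (Z Z' : SemialgebraicCubicalChain d N) (n : ℕ) (hn : n ≠ 0)
    (hZ : n • (Z - Z') = SemialgebraicCubicalChain.boundary Γ) :
    KZ.chainRep Z ω - KZ.chainRep Z' ω ∈ KZ.relations := by
  refine hT n _ hn ?_
  rw [← KZ.chainRep_sub, ← KZ.chainRepHom_apply, ← map_nsmul, hZ, KZ.chainRepHom_apply]
  refine chainRep_boundary_mem_relations hSo hω hωd Γ (fun c hc => (hΓV c hc).mono_right hVS) hΓ2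
    fun c hc y hy => ?_
  rw [pullbackDensity_apply]
  exact hdωV _ (hΓV c hc (openUnitCube_subset_closedUnitCube hy)) _ fun i =>
    fderiv_apply_mem_tangentConeAt c ((hΓV c hc).mono_left openUnitCube_subset_closedUnitCube) hy _

/-! ## Forms with `ℚ`-polynomial coefficients on `ℝᴺ` -/

/-- A form `ω = Σ_{I ∈ s} a_I dx_{e I}` with polynomial coefficients `a_I ∈ ℚ[x₁, …, x_N]` has
`ℚ`-semialgebraic coefficients on all of `ℝᴺ`. [cite: BochnakCosteRoy1998, Prop. 2.2.6] -/
theorem isSemialgebraicFormOn_polynomialForm {ι : Type*} (s : Finset ι) (e : ι → Fin d → Fin N)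
    (a : ι → MvPolynomial (Fin N) ℚ) :
    IsSemialgebraicFormOn univ
      (fun x => ∑ I ∈ s, (MvPolynomial.aeval x (a I) : ℝ) • basicForm (e I)) :=
  isSemialgebraicFormOn_sum_smul_basicForm s e
    (Literature.ModelTheory.ExponentialFields.isSemialgebraic_univ) fun I _ =>
    isSemialgebraicFunOn_aeval (Literature.ModelTheory.ExponentialFields.isSemialgebraic_univ) (a I)

/-- A form with polynomial coefficients is differentiable on `ℝᴺ`. [folklore] -/
theorem differentiable_polynomialForm {ι : Type*} (s : Finset ι) (e : ι → Fin d → Fin N)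
    (a : ι → MvPolynomial (Fin N) ℚ) :
    Differentiable ℝ (fun x => ∑ I ∈ s, (MvPolynomial.aeval x (a I) : ℝ) • basicForm (e I)) :=
  Differentiable.fun_sum fun I _ =>
    ((contDiff_aeval_real (n := 1) (a I)).differentiable one_ne_zero).smul_const _

/-- **CobordismInvariance for forms with `ℚ`-polynomial coefficients** (the informal item's setting:
`ω = Σ_I a_I dx_I`, `a_I ∈ ℚ[x₁, …, x_N]`, closed on `V` in the sense that `dω` kills tuples of
tangent-cone vectors of `V`): chains `Z, Z'` homologous in `V` through a Nash `(d+1)`-chain `Γ`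
(cells in `V`, `C²` on the open cube) have KZ-equivalent representations,
`KZ.chainRep Z ω − KZ.chainRep Z' ω ∈ KZ.relations`. [cite: KontsevichZagier2001, §1.2, rule (3)] -/
theorem cobordismInvariance_polynomialForm {ι : Type*} (s : Finset ι) (e : ι → Fin d → Fin N)
    (a : ι → MvPolynomial (Fin N) ℚ) {V : Set (Fin N → ℝ)}
    (hdωV : ∀ x ∈ V, ∀ v : Fin (d + 1) → (Fin N → ℝ), (∀ i, v i ∈ tangentConeAt ℝ V x) →
      extDeriv (fun x => ∑ I ∈ s, (MvPolynomial.aeval x (a I) : ℝ) • basicForm (e I)) x v = 0)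
    (Γ : SemialgebraicCubicalChain (d + 1) N)
    (hΓV : ∀ c ∈ Γ.support, MapsTo c (closedUnitCube (d + 1)) V)
    (hΓ2 : ∀ c ∈ Γ.support, ContDiffOn ℝ 2 c (openUnitCube (d + 1)))
    (Z Z' : SemialgebraicCubicalChain d N) (hZ : Z - Z' = SemialgebraicCubicalChain.boundary Γ) :
    KZ.chainRep Z (fun x => ∑ I ∈ s, (MvPolynomial.aeval x (a I) : ℝ) • basicForm (e I)) -
        KZ.chainRep Z' (fun x => ∑ I ∈ s, (MvPolynomial.aeval x (a I) : ℝ) • basicForm (e I)) ∈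
      KZ.relations :=
  cobordismInvariance isOpen_univ (isSemialgebraicFormOn_polynomialForm s e a)
    (differentiable_polynomialForm s e a).differentiableOn (subset_univ V) hdωV Γ hΓV hΓ2 Z Z' hZ

end Summit.KontsevichZagierPeriods.CobordismMove.CobordismInvariance
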